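import Mathlib
import Summits.MatrixMultiplication.MatrixMultiplication.Cruxes.PolynomialSlack.IdeaSketchIdeator3

/-!
# drefute g2 — INHERITANCE LEMMA for line `quotient-globalisation-by-pruning` (crux PolynomialSlack)

Positive evidence for the lead (stub `stub_pairwiseGlobalisation` = C⁺_pw): within-stabiliser globalness of a
FULL quotient `S⁻¹T` is inherited from the spreadness of the LEFT factor alone.  For `S, T` inside one left
coset `g·Stab_pw(L)` with `|S⁻¹T| = |S||T|`:

  `IsGlobalWithin (stabFinset L) r (g⁻¹ • S)  →  IsGlobalWithin (stabFinset L) r (S⁻¹T)`   (any `T ⊆ g·Stab_pw(L)`).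

Mechanism (`DrefuteQuotientGlobalisationG2.md` §4(d)): `σ = s⁻¹x` lies in `U_{I→J}` iff `x∘I = s∘J`, so
`|S⁻¹T ∩ U_{I→J}| ≤ Σ_{x∈T} |S ∩ U_{J→x∘I}|`; each summand is controlled by the spreadness of `g⁻¹S` at the
umvirate `U_{J→g⁻¹x∘I}`, and `h ↦ h⁻¹(g⁻¹x)` injects `Stab ∩ U_{J→g⁻¹x∘I}` into `Stab ∩ U_{I→J}`.
Consequence: C⁺_pw follows from spreadness of TWO of the three pruned factors (the third only has to sit in the
common coset and have the right parity).  Sorry-free; `lean check` rc 0.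
-/

set_option linter.dupNamespace false

open Finset
open Summit.MatrixMultiplication.MatrixMultiplication.Cruxes.PolynomialSlack.IdeaSketch (IsGlobalWithin stabFinset)

namespace Summit.MatrixMultiplication.MatrixMultiplication.Cruxes.PolynomialSlack.QuotientGlobalisationByPruning.G2

variable {n : ℕ}

/-- The quotient set `S⁻¹T`. -/
abbrev quot (S T : Finset (Equiv.Perm (Fin n))) : Finset (Equiv.Perm (Fin n)) :=
  Finset.image₂ (fun s x => s⁻¹ * x) S T

/-- If `S, T` lie in the left coset `g·Stab_pw(L)` then `S⁻¹T ⊆ Stab_pw(L)`. -/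
theorem quot_subset_stab {t₀ : ℕ} (L : Fin t₀ → Fin n) (g : Equiv.Perm (Fin n))
    {S T : Finset (Equiv.Perm (Fin n))}
    (hS : ∀ s ∈ S, ∀ k, s (L k) = g (L k)) (hT : ∀ x ∈ T, ∀ k, x (L k) = g (L k)) :
    quot S T ⊆ stabFinset L := by
  intro σ hσ
  simp only [Finset.mem_image₂] at hσ
  obtain ⟨s, hs, x, hx, rfl⟩ := hσ
  simp only [stabFinset, mem_filter, mem_univ, true_and]
  intro k
  rw [Equiv.Perm.mul_apply, hT x hx k, ← hS s hs k]
  simp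

/-- Counting: `|S⁻¹T ∩ U_{I→J}| ≤ Σ_{x∈T} |{s ∈ S : s∘J = x∘I}|`. -/
theorem card_quot_filter_le (S T : Finset (Equiv.Perm (Fin n))) {t : ℕ} (I J : Fin t → Fin n) :
    ((quot S T).filter (fun σ => ∀ k, σ (I k) = J k)).card ≤
      ∑ x ∈ T, (S.filter (fun s => ∀ k, s (J k) = x (I k))).card := by
  classical
  set pairs := (S ×ˢ T).filter (fun p => ∀ k, p.1 (J k) = p.2 (I k)) with hpairs
  have hsub : (quot S T).filter (fun σ => ∀ k, σ (I k) = J k) ⊆ pairs.image (fun p => p.1⁻¹ * p.2) := by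
    intro σ hσ
    simp only [mem_filter, Finset.mem_image₂] at hσ
    obtain ⟨⟨s, hs, x, hx, rfl⟩, hIJ⟩ := hσ
    refine mem_image.mpr ⟨(s, x), ?_, rfl⟩
    simp only [hpairs, mem_filter, mem_product]
    refine ⟨⟨hs, hx⟩, fun k => ?_⟩
    have := hIJ k
    rw [Equiv.Perm.mul_apply] at this
    -- s⁻¹ (x (I k)) = J k  ⇒  x (I k) = s (J k)
    have h2 := congrArg s this
    simpa using h2.symm
  calc ((quot S T).filter (fun σ => ∀ k, σ (I k) = J k)).card
      ≤ (pairs.image (fun p => p.1⁻¹ * p.2)).card := card_le_card hsub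
    _ ≤ pairs.card := card_image_le
    _ = ∑ p ∈ S ×ˢ T, (if (∀ k, p.1 (J k) = p.2 (I k)) then 1 else 0) := by
        rw [hpairs, Finset.card_filter]
    _ = ∑ x ∈ T, ∑ s ∈ S, (if (∀ k, s (J k) = x (I k)) then 1 else 0) := Finset.sum_product_right _ _ _
    _ = ∑ x ∈ T, (S.filter (fun s => ∀ k, s (J k) = x (I k))).card := by
        refine Finset.sum_congr rfl (fun x _ => ?_)
        rw [Finset.card_filter]

/-- The host counts: `h ↦ h⁻¹ (g⁻¹ x)` injects `Stab ∩ U_{J → g⁻¹x∘I}` into `Stab ∩ U_{I→J}` (`x ∈ g·Stab`). -/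
theorem card_stab_filter_le {t₀ : ℕ} (L : Fin t₀ → Fin n) (g x : Equiv.Perm (Fin n))
    (hx : ∀ k, x (L k) = g (L k)) {t : ℕ} (I J : Fin t → Fin n) :
    ((stabFinset L).filter (fun h => ∀ k, h (J k) = g⁻¹ (x (I k)))).card ≤
      ((stabFinset L).filter (fun h => ∀ k, h (I k) = J k)).card := by
  refine Finset.card_le_card_of_injOn (fun h => h⁻¹ * (g⁻¹ * x)) ?_ ?_
  · intro h hh
    simp only [coe_filter, Set.mem_setOf_eq, stabFinset, mem_filter, mem_univ, true_and] at hh ⊢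
    obtain ⟨hstab, hJ⟩ := hh
    constructor
    · intro k
      simp only [Equiv.Perm.mul_apply]
      rw [hx k]
      have e1 : g⁻¹ (g (L k)) = L k := by simp
      rw [e1, Equiv.Perm.inv_eq_iff_eq]
      exact (hstab k).symm
    · intro k
      simp only [Equiv.Perm.mul_apply]
      rw [← hJ k]
      simp
  · intro h₁ _ h₂ _ he
    have : h₁⁻¹ = h₂⁻¹ := mul_right_cancel he
    exact inv_injective this

/-- **Inheritance lemma.**  `S, T ⊆ g·Stab_pw(L)`, full quotient, and `g⁻¹S` `r`-global within `Stab_pw(L)`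
imply `S⁻¹T` is `r`-global within `Stab_pw(L)` — whatever `T` is. -/
theorem isGlobalWithin_quot {t₀ : ℕ} (L : Fin t₀ → Fin n) (g : Equiv.Perm (Fin n))
    (S T : Finset (Equiv.Perm (Fin n))) (r : ℝ)
    (hS : ∀ s ∈ S, ∀ k, s (L k) = g (L k)) (hT : ∀ x ∈ T, ∀ k, x (L k) = g (L k))
    (hfull : (quot S T).card = S.card * T.card)
    (hglob : IsGlobalWithin (stabFinset L) r (S.image (fun s => g⁻¹ * s))) :
    IsGlobalWithin (stabFinset L) r (quot S T) := by
  classical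
  refine ⟨quot_subset_stab L g hS hT, ?_⟩
  intro t I J hI hJ
  set H := stabFinset L with hH
  set hV : ℝ := ((H.filter (fun h => ∀ k, h (I k) = J k)).card : ℝ) with hhV
  have hHpos : (0 : ℝ) < H.card := by
    have : (1 : Equiv.Perm (Fin n)) ∈ H := by simp [hH, stabFinset]
    exact_mod_cast Finset.card_pos.mpr ⟨1, this⟩
  have hr2 : (0 : ℝ) ≤ r ^ (2 * t) := by rw [pow_mul]; positivity
  -- per-`x` bound from the spreadness of `g⁻¹ S`
  have hper : ∀ x ∈ T, ((S.filter (fun s => ∀ k, s (J k) = x (I k))).card : ℝ) * H.card ≤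
      r ^ (2 * t) * S.card * hV := by
    intro x hx
    -- the umvirate `J → w`, `w := g⁻¹ ∘ x ∘ I`
    set w : Fin t → Fin n := fun k => g⁻¹ (x (I k)) with hw
    have hwinj : Function.Injective w := by
      intro a b hab
      simp only [hw] at hab
      exact hI (x.injective (g⁻¹.injective hab))
    have hg := hglob.2 t J w hJ hwinj
    -- identify the filtered image with the filtered set
    have hcard : ((S.image (fun s => g⁻¹ * s)).filter (fun σ => ∀ k, σ (J k) = w k)).card =
        (S.filter (fun s => ∀ k, s (J k) = x (I k))).card := by
      rw [Finset.filter_image]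
      rw [Finset.card_image_of_injective _ (mul_right_injective g⁻¹)]
      congr 1
      ext s
      simp only [mem_filter, hw, Equiv.Perm.mul_apply]
      refine and_congr_right (fun _ => forall_congr' (fun k => ?_))
      constructor
      · intro h; exact g⁻¹.injective h
      · intro h; rw [h]
    have hcardS : ((S.image (fun s => g⁻¹ * s)).card : ℝ) = S.card := by
      rw [Finset.card_image_of_injective _ (mul_right_injective g⁻¹)]
    rw [hcard, hcardS] at hg
    have hhost : (((H.filter (fun h => ∀ k, h (J k) = w k)).card : ℝ)) ≤ hV := by
      rw [hhV]; exact_mod_cast card_stab_filter_le L g x (hT x hx) I J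
    calc ((S.filter (fun s => ∀ k, s (J k) = x (I k))).card : ℝ) * H.card
        ≤ r ^ (2 * t) * S.card * ((H.filter (fun h => ∀ k, h (J k) = w k)).card : ℝ) := hg
      _ ≤ r ^ (2 * t) * S.card * hV := by
          apply mul_le_mul_of_nonneg_left hhost; positivity
  -- sum over `x ∈ T`
  have hsum : (((quot S T).filter (fun σ => ∀ k, σ (I k) = J k)).card : ℝ) * H.card ≤
      (T.card : ℝ) * (r ^ (2 * t) * S.card * hV) := by
    have h1 : (((quot S T).filter (fun σ => ∀ k, σ (I k) = J k)).card : ℝ) ≤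
        ∑ x ∈ T, ((S.filter (fun s => ∀ k, s (J k) = x (I k))).card : ℝ) := by
      exact_mod_cast card_quot_filter_le S T I J
    calc (((quot S T).filter (fun σ => ∀ k, σ (I k) = J k)).card : ℝ) * H.card
        ≤ (∑ x ∈ T, ((S.filter (fun s => ∀ k, s (J k) = x (I k))).card : ℝ)) * H.card :=
          mul_le_mul_of_nonneg_right h1 hHpos.le
      _ = ∑ x ∈ T, ((S.filter (fun s => ∀ k, s (J k) = x (I k))).card : ℝ) * H.card := Finset.sum_mul _ _ _
      _ ≤ ∑ _x ∈ T, r ^ (2 * t) * S.card * hV := Finset.sum_le_sum hper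
      _ = (T.card : ℝ) * (r ^ (2 * t) * S.card * hV) := by rw [Finset.sum_const, nsmul_eq_mul]
  have hX : ((quot S T).card : ℝ) = S.card * T.card := by exact_mod_cast hfull
  calc (((quot S T).filter (fun σ => ∀ k, σ (I k) = J k)).card : ℝ) * H.card
      ≤ (T.card : ℝ) * (r ^ (2 * t) * S.card * hV) := hsum
    _ = r ^ (2 * t) * ((quot S T).card : ℝ) * hV := by rw [hX]; ring

end Summit.MatrixMultiplication.MatrixMultiplication.Cruxes.PolynomialSlack.QuotientGlobalisationByPruning.G2
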